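import Mathlib
import Summits.Ventures.HodgeRepro2.T6N5Skeleton
import Summits.Ventures.HodgeRepro2.T6N5LocalDatum
import Summits.Ventures.HodgeRepro2.T6N5Local

/-!
# T6N5LocalSides — Tier 6, M2 sub-step N5 (t6-p8's half): condition (b) of both toric sides from
place-by-place solvability of the coupled local system

The glue between the local theorems (`N5Local_main`, `N5Local_main_inert_weil`, `N5Local_main_ram_weil`: at each
finite non-split place `v` SOME quadruple solves TIER5 §N5.11.5's coupled system) and t6-p7's `ToricSide.condB`
on both sides: choose a solution at every place (`Classical.choice`) and apply `N5Local.condB_sides`. The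
assembler needs only `∀ v, ∃ ξ, LocalSolution (D v) ξ` — the shape each local theorem delivers.
v2 (append-only): `condB_of_localSolution_A` / `_B` — condition (b) for ANY side `X` (the lead's carrier side, not
only `sideA` / `sideB`) whose sign fields agree pointwise with the local data and solutions.
README §8(d): uses an L-value-free non-vanishing device: NO.
-/

namespace Summit.Ventures.HodgeRepro2.T6.N5LocalSides

open Summit.Ventures.HodgeRepro2.T6.N5LocalDatum Summit.Ventures.HodgeRepro2.T6.N5Skeleton
  Summit.Ventures.HodgeRepro2.T6.N5Local

variable {ι G : Type*} [CommGroup G]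

/-- A family of local solutions from place-by-place solvability. -/
theorem exists_family_of_forall_exists (D : ι → LocalSignDatum)
    (h : ∀ v, ∃ ξ : Fin 4 → (D v).Char, LocalSolution (D v) ξ) :
    ∃ ξ : ∀ v, Fin 4 → (D v).Char, ∀ v, LocalSolution (D v) (ξ v) :=
  ⟨fun v => (h v).choose, fun v => (h v).choose_spec⟩

/-- Condition (b) of TIER5 §N5.5 on BOTH sides from place-by-place solvability of the coupled local system:
there are local solutions `ξ` at every place of `ι` with `(sideA XA D ξ).condB ∧ (sideB XB D ξ).condB` and the
(S-H) identity `ξ_c ξ_d = ξ_a ξ_b` at every place. -/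
theorem condB_of_forall_exists (XA XB : ToricSide ι G) (D : ι → LocalSignDatum)
    (h : ∀ v, ∃ ξ : Fin 4 → (D v).Char, LocalSolution (D v) ξ) :
    ∃ ξ : ∀ v, Fin 4 → (D v).Char, ((sideA XA D ξ).condB ∧ (sideB XB D ξ).condB) ∧
      ∀ v, ξ v 2 * ξ v 3 = ξ v 0 * ξ v 1 := by
  obtain ⟨ξ, hξ⟩ := exists_family_of_forall_exists D h
  exact ⟨ξ, condB_sides XA XB D ξ hξ, shiftHermitian_sides D ξ hξ⟩

/-- Condition (b) for ANY side `X` whose sign fields agree pointwise with local solutions: side A's pattern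
(`omega v i = ω_{E_v/F_v}(λ_i)`, `eps v i = ε_v(ξ_{i,v})` for the lines `a = 0`, `b = 1`). -/
theorem condB_of_localSolution_A (X : ToricSide ι G) (D : ι → LocalSignDatum) (ξ : ∀ v, Fin 4 → (D v).Char)
    (hξ : ∀ v, LocalSolution (D v) (ξ v))
    (hω : ∀ v (i : Fin 2), X.omega v i = (D v).ηLine i)
    (hε : ∀ v (i : Fin 2), X.eps v i = (D v).eps (ξ v (Fin.castLE (by decide) i))) : X.condB := by
  intro v i
  rw [hω, hε]
  obtain ⟨-, h0, h1, -, -, -⟩ := hξ v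
  fin_cases i
  · exact h0.symm
  · exact h1.symm

/-- Condition (b) for ANY side `X` with side B's pattern (`omega v i = η_v(u)·ω_{E_v/F_v}(λ_i)`,
`eps v i = ε_v(ξ_{i+2,v})` for the lines `c = 2`, `d = 3`). -/
theorem condB_of_localSolution_B (X : ToricSide ι G) (D : ι → LocalSignDatum) (ξ : ∀ v, Fin 4 → (D v).Char)
    (hξ : ∀ v, LocalSolution (D v) (ξ v))
    (hω : ∀ v (i : Fin 2), X.omega v i = (D v).ηu * (D v).ηLine i)
    (hε : ∀ v (i : Fin 2), X.eps v i = (D v).eps (ξ v (i.addNat 2))) : X.condB := by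
  intro v i
  rw [hω, hε]
  obtain ⟨-, -, -, h2, h3, -⟩ := hξ v
  fin_cases i
  · exact h2.symm
  · exact h3.symm

end Summit.Ventures.HodgeRepro2.T6.N5LocalSides
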